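import Summits.ValiantsHypothesis.ValiantsHypothesis.Theorems.GirthSidonToricSwallowForcesShortRelationWalks

/-!
# GirthSidon / ToricSwallowForcesShortRelation — a Moore-type bound valued in short relations
(support file 2/3)

Support file for item `stmt-ValiantsHypothesis-6538` (`ToricSwallowForcesShortRelation`) of route
GirthSidon (problem `ValiantsHypothesis`); setting and the hypothesis `hball` as in `…Walks.lean`.

Main result `pow_le_card_of_noRel` (weak Moore bound): if every vertex of the nonempty `W` has at
least `c` neighbours in `W` (adjacency induced by a duplicate-free edge family `verts` on `A`) and
there is no relation of length `≤ k`, then `(c - 2) ^ k ≤ |W|`.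
Proof: with no relations, a vertex outside `ball t` is adjacent to at most one vertex of layer
`t` when `t + 1 ≤ k` (`eq_of_adj_adj_of_noRel`: two such neighbours give two layered walks of
length `t + 1` with common ends; the even steps of one with the odd steps of the other form a
relation against the complementary choice, nontrivial because the last step of the first walk
occurs exactly once); hence `|layer (t+1)| ≥ (c - 2) · |layer t|` (`card_layer_succ_ge`, double
counting) and `|W| ≥ |layer k| ≥ (c - 2) ^ k`.
This replaces the even-cycle (Bondy–Simonovits / Moore) step of the planner's sketch by a
relation-valued Moore bound and needs no bipartite reduction.  Everything here is folklore.
-/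

set_option linter.dupNamespace false -- single-conjunct summit: `ValiantsHypothesis.ValiantsHypothesis`

namespace Summit.ValiantsHypothesis.ValiantsHypothesis.Theorems.GirthSidonToric

open Finset

variable {V ι : Type*}

section BFS

variable {A : Finset ι} {verts : ι → Multiset V} {W : Finset V} {r : V} {ball : ℕ → Finset V}
  [DecidableEq V]

/-- **No collisions without short relations.** If no two distinct multisets of at most `k` edges
have the same endpoint union, then a vertex outside `ball t` (`t + 1 ≤ k`) is adjacent to at most
one vertex of layer `t`. [folklore] -/
theorem eq_of_adj_adj_of_noRel
    (hball : ball 0 = ∅ ∧ ∀ t v, v ∈ ball (t + 1) ↔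
      v = r ∨ v ∈ ball t ∨ (v ∈ W ∧ ∃ u ∈ ball t, ∃ i ∈ A, verts i = {u, v}))
    (hA : ∀ i ∈ A, (verts i).Nodup) {k : ℕ}
    (hnorel : ∀ S T : Multiset ι, (∀ i ∈ S, i ∈ A) → (∀ i ∈ T, i ∈ A) →
      Multiset.card S ≤ k → Multiset.card T ≤ k → (S.map verts).sum = (T.map verts).sum → S = T)
    {t : ℕ} (htk : t + 1 ≤ k) {x w₁ w₂ : V} (hx : x ∉ ball t)
    (hw₁ : w₁ ∈ ball (t + 1) \ ball t) (hw₂ : w₂ ∈ ball (t + 1) \ ball t)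
    (h₁ : ∃ i ∈ A, verts i = {w₁, x}) (h₂ : ∃ i ∈ A, verts i = {w₂, x}) : w₁ = w₂ := by
  by_contra hne
  obtain ⟨p, hpt, hpl, hpa⟩ := exists_walk_of_mem_layer hball hw₁
  obtain ⟨q, hqt, hql, hqa⟩ := exists_walk_of_mem_layer hball hw₂
  obtain ⟨i₁, hi₁A, hi₁⟩ := h₁
  obtain ⟨i₂, hi₂A, hi₂⟩ := h₂
  obtain ⟨e, he⟩ := exists_edges hpa i₁
  obtain ⟨f, hf⟩ := exists_edges hqa i₁
  have hp0 : p 0 = r := by simpa [layer_zero hball] using hpl 0 (Nat.zero_le _)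
  have hq0 : q 0 = r := by simpa [layer_zero hball] using hql 0 (Nat.zero_le _)
  have hw₁x : w₁ ≠ x := ne_of_adj hA ⟨i₁, hi₁A, hi₁⟩
  have hw₂x : w₂ ≠ x := ne_of_adj hA ⟨i₂, hi₂A, hi₂⟩
  -- a walk vertex is never `x`
  have hpx : ∀ j ≤ t, p j ≠ x := by
    intro j hj h
    rcases Nat.lt_or_ge j t with hjt | hjt
    · exact hx (h ▸ layer_subset_ball hball hjt (hpl j hj))
    · obtain rfl : j = t := le_antisymm hj hjt
      exact hw₁x (hpt ▸ h)
  have hqx : ∀ j ≤ t, q j ≠ x := by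
    intro j hj h
    rcases Nat.lt_or_ge j t with hjt | hjt
    · exact hx (h ▸ layer_subset_ball hball hjt (hql j hj))
    · obtain rfl : j = t := le_antisymm hj hjt
      exact hw₂x (hqt ▸ h)
  -- the extended walks `r … w₁ x` and `r … w₂ x`
  set P : ℕ → V := fun j => if j ≤ t then p j else x with hP
  set Q : ℕ → V := fun j => if j ≤ t then q j else x with hQ
  set E : ℕ → ι := fun j => if j < t then e j else i₁ with hE
  set F : ℕ → ι := fun j => if j < t then f j else i₂ with hF
  have hEv : ∀ j < t + 1, verts (E j) = {P j, P (j + 1)} := by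
    intro j hj
    rcases Nat.lt_or_ge j t with hjt | hjt
    · have h' : j + 1 ≤ t := hjt
      simp only [hE, hP, hjt, if_true, hjt.le, h', (he j hjt).2]
    · obtain rfl : j = t := by omega
      simp [hE, hP, hpt, hi₁]
  have hFv : ∀ j < t + 1, verts (F j) = {Q j, Q (j + 1)} := by
    intro j hj
    rcases Nat.lt_or_ge j t with hjt | hjt
    · have h' : j + 1 ≤ t := hjt
      simp only [hF, hQ, hjt, if_true, hjt.le, h', (hf j hjt).2]
    · obtain rfl : j = t := by omega
      simp [hF, hQ, hqt, hi₂]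
  have hEA : ∀ j, E j ∈ A := fun j => by
    by_cases hjt : j < t
    · simpa [hE, hjt] using (he j hjt).1
    · simpa [hE, hjt] using hi₁A
  have hFA : ∀ j, F j ∈ A := fun j => by
    by_cases hjt : j < t
    · simpa [hF, hjt] using (hf j hjt).1
    · simpa [hF, hjt] using hi₂A
  have hsum := two_walks_sum_eq verts P Q E F (t + 1) hEv hFv (by simp [hP, hQ, hp0, hq0])
    (by simp [hP, hQ])
  have hcard : ∀ (a b : Finset ℕ), a.card + b.card = t + 1 →
      Multiset.card (a.val.map E + b.val.map F) ≤ k := fun a b hab => by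
    simpa [hab] using htk
  have hmem : ∀ (a b : Finset ℕ), ∀ i ∈ a.val.map E + b.val.map F, i ∈ A := by
    intro a b i hi
    simp only [Multiset.mem_add, Multiset.mem_map, Finset.mem_val] at hi
    rcases hi with ⟨j, -, rfl⟩ | ⟨j, -, rfl⟩
    exacts [hEA j, hFA j]
  have hc1 := Finset.card_filter_add_card_filter_not (s := range (t + 1)) (fun j => Even j)
  rw [card_range] at hc1
  have hST := hnorel _ _ (hmem _ _) (hmem _ _) (hcard _ _ hc1) (hcard _ _ (by rw [add_comm, hc1]))
    hsum
  -- the edge `i₁` (endpoints `{w₁, x}`) occurs exactly once among the steps of the two walks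
  have hE_ne : ∀ j < t, E j ≠ i₁ := by
    intro j hjt h
    have hv := (he j hjt).2
    simp only [hE, hjt, if_true] at h
    rw [h, hi₁, pair_eq_pair_iff] at hv
    rcases hv with ⟨-, h2⟩ | ⟨-, h2⟩
    · exact hpx (j + 1) hjt h2.symm
    · exact hpx j hjt.le h2.symm
  have hF_ne : ∀ j < t + 1, F j ≠ i₁ := by
    intro j hj h
    rcases Nat.lt_or_ge j t with hjt | hjt
    · have hv := (hf j hjt).2
      simp only [hF, hjt, if_true] at h
      rw [h, hi₁, pair_eq_pair_iff] at hv
      rcases hv with ⟨-, h2⟩ | ⟨-, h2⟩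
      · exact hqx (j + 1) hjt h2.symm
      · exact hqx j hjt.le h2.symm
    · obtain rfl : j = t := by omega
      simp only [hF, lt_irrefl, if_false] at h
      have hv := hi₂
      rw [h, hi₁, pair_eq_pair_iff] at hv
      rcases hv with ⟨h2, -⟩ | ⟨h2, h3⟩
      · exact hne h2
      · exact hne (h2.trans h3)
  have key : ∀ (c : ℕ → Prop) [DecidablePred c],
      i₁ ∈ ((range (t + 1)).filter c).val.map E + ((range (t + 1)).filter (fun j => ¬ c j)).val.map F
        ↔ c t := by
    intro c _
    simp only [Multiset.mem_add, Multiset.mem_map, Finset.mem_val, mem_filter, mem_range]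
    constructor
    · rintro (⟨j, ⟨hj, hcj⟩, hji⟩ | ⟨j, ⟨hj, -⟩, hji⟩)
      · rcases Nat.lt_or_ge j t with hjt | hjt
        · exact absurd hji (hE_ne j hjt)
        · obtain rfl : j = t := by omega
          exact hcj
      · exact absurd hji (hF_ne j hj)
    · intro hct
      exact Or.inl ⟨t, ⟨Nat.lt_succ_self t, hct⟩, by simp [hE]⟩
  have k1 := key (fun j => Even j)
  have k2 := key (fun j => ¬ Even j)
  simp only [not_not] at k2
  rw [hST] at k1
  exact (not_iff_self (k1.symm.trans k2).symm).elim

/-- **Layer growth.** With all degrees `≥ c` and no relation of length `≤ k`, layer `t + 1` is at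
least `c - 2` times as large as layer `t` (`t + 1 ≤ k`). [folklore] -/
theorem card_layer_succ_ge
    (hball : ball 0 = ∅ ∧ ∀ t v, v ∈ ball (t + 1) ↔
      v = r ∨ v ∈ ball t ∨ (v ∈ W ∧ ∃ u ∈ ball t, ∃ i ∈ A, verts i = {u, v}))
    (hr : r ∈ W) (hA : ∀ i ∈ A, (verts i).Nodup) {k c : ℕ}
    (hnorel : ∀ S T : Multiset ι, (∀ i ∈ S, i ∈ A) → (∀ i ∈ T, i ∈ A) →
      Multiset.card S ≤ k → Multiset.card T ≤ k → (S.map verts).sum = (T.map verts).sum → S = T)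
    (hdeg : ∀ v ∈ W, c ≤ (W.filter fun x => ∃ i ∈ A, verts i = {v, x}).card) {t : ℕ}
    (htk : t + 1 ≤ k) :
    (c - 2) * (ball (t + 1) \ ball t).card ≤ (ball (t + 1 + 1) \ ball (t + 1)).card := by
  have hcoll := fun {s : ℕ} (hs : s + 1 ≤ k) {x w₁ w₂ : V} =>
    eq_of_adj_adj_of_noRel hball hA hnorel hs (x := x) (w₁ := w₁) (w₂ := w₂)
  -- Step 1: every vertex of layer `t` has at least `c - 2` neighbours in layer `t + 1`.
  have step1 : ∀ w ∈ ball (t + 1) \ ball t, c - 2 ≤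
      ((ball (t + 1 + 1) \ ball (t + 1)).filter fun x => ∃ i ∈ A, verts i = {w, x}).card := by
    intro w hw
    have hwW : w ∈ W := ball_subset hball hr (t + 1) (mem_sdiff.1 hw).1
    have hwt : w ∉ ball t := (mem_sdiff.1 hw).2
    -- neighbours outside `ball (t+1)` are in layer `t + 1`
    have hout : ((W.filter fun x => ∃ i ∈ A, verts i = {w, x}).filter
        fun x => x ∉ ball (t + 1)) ⊆
        (ball (t + 1 + 1) \ ball (t + 1)).filter fun x => ∃ i ∈ A, verts i = {w, x} := by
      intro x hx
      rw [mem_filter, mem_filter] at hx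
      rw [mem_filter, mem_sdiff]
      exact ⟨⟨mem_ball_succ_of_adj hball (mem_sdiff.1 hw).1 hx.1.1 hx.1.2, hx.2⟩, hx.1.2⟩
    -- at most two neighbours inside `ball (t+1)`
    have hin : ((W.filter fun x => ∃ i ∈ A, verts i = {w, x}).filter
        fun x => x ∈ ball (t + 1)).card ≤ 2 := by
      cases t with
      | zero =>
        rw [layer_zero hball, mem_singleton] at hw
        subst hw
        have : ((W.filter fun x => ∃ i ∈ A, verts i = {w, x}).filter
            fun x => x ∈ ball (0 + 1)) = ∅ := by
          refine filter_eq_empty_iff.2 fun x hx hx1 => ?_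
          rcases (hball.2 0 x).1 hx1 with rfl | h | ⟨-, u, hu, -⟩
          · exact ne_of_adj hA (mem_filter.1 hx).2 rfl
          · simp [hball.1] at h
          · simp [hball.1] at hu
        rw [this]
        exact Nat.zero_le _
      | succ t =>
        have hsub : ((W.filter fun x => ∃ i ∈ A, verts i = {w, x}).filter
            fun x => x ∈ ball (t + 1 + 1)) ⊆
            ((ball (t + 1 + 1) \ ball (t + 1)).filter fun x => ∃ i ∈ A, verts i = {x, w}) ∪
              ((ball (t + 1) \ ball t).filter fun x => ∃ i ∈ A, verts i = {x, w}) := by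
          intro x hx
          rw [mem_filter, mem_filter] at hx
          have hxw : ∃ i ∈ A, verts i = {x, w} := adj_symm hx.1.2
          have hxt : x ∉ ball t := fun h => hwt (mem_ball_succ_of_adj hball h hwW hxw)
          rw [mem_union, mem_filter, mem_filter, mem_sdiff, mem_sdiff]
          by_cases hx1 : x ∈ ball (t + 1)
          · exact Or.inr ⟨⟨hx1, hxt⟩, hxw⟩
          · exact Or.inl ⟨⟨hx.2, hx1⟩, hxw⟩
        have c1 : ((ball (t + 1 + 1) \ ball (t + 1)).filter
            fun x => ∃ i ∈ A, verts i = {x, w}).card ≤ 1 :=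
          card_le_one.2 fun a ha b hb => by
            rw [mem_filter] at ha hb
            exact hcoll htk hwt ha.1 hb.1 ha.2 hb.2
        have c2 : ((ball (t + 1) \ ball t).filter fun x => ∃ i ∈ A, verts i = {x, w}).card ≤ 1 :=
          card_le_one.2 fun a ha b hb => by
            rw [mem_filter] at ha hb
            exact hcoll (by omega) (fun h => hwt (ball_subset_succ hball _ h)) ha.1 hb.1 ha.2 hb.2
        have c3 := card_le_card hsub
        have c4 := card_union_le
          ((ball (t + 1 + 1) \ ball (t + 1)).filter fun x => ∃ i ∈ A, verts i = {x, w})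
          ((ball (t + 1) \ ball t).filter fun x => ∃ i ∈ A, verts i = {x, w})
        omega
    have hsplit := Finset.card_filter_add_card_filter_not
      (s := W.filter fun x => ∃ i ∈ A, verts i = {w, x}) (fun x => x ∈ ball (t + 1))
    have h1 := hdeg w hwW
    have h2 := card_le_card hout
    omega
  -- Step 2: double counting of the edges between the two layers.
  have hdc := Finset.sum_card_bipartiteAbove_eq_sum_card_bipartiteBelow
    (s := ball (t + 1) \ ball t) (t := ball (t + 1 + 1) \ ball (t + 1))
    (r := fun w x => ∃ i ∈ A, verts i = {w, x})
  simp only [bipartiteAbove, bipartiteBelow] at hdc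
  -- Step 3: every vertex of layer `t + 1` has at most one neighbour in layer `t`.
  have step3 : ∀ x ∈ ball (t + 1 + 1) \ ball (t + 1),
      ((ball (t + 1) \ ball t).filter fun w => ∃ i ∈ A, verts i = {w, x}).card ≤ 1 := by
    intro x hx
    refine card_le_one.2 fun a ha b hb => ?_
    rw [mem_filter] at ha hb
    exact hcoll htk (fun h => (mem_sdiff.1 hx).2 (ball_subset_succ hball _ h)) ha.1 hb.1 ha.2 hb.2
  calc (c - 2) * (ball (t + 1) \ ball t).card
      = ∑ _w ∈ ball (t + 1) \ ball t, (c - 2) := by rw [sum_const, smul_eq_mul, mul_comm]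
    _ ≤ ∑ w ∈ ball (t + 1) \ ball t,
          ((ball (t + 1 + 1) \ ball (t + 1)).filter fun x => ∃ i ∈ A, verts i = {w, x}).card :=
        sum_le_sum step1
    _ = ∑ x ∈ ball (t + 1 + 1) \ ball (t + 1),
          ((ball (t + 1) \ ball t).filter fun w => ∃ i ∈ A, verts i = {w, x}).card := hdc
    _ ≤ ∑ _x ∈ ball (t + 1 + 1) \ ball (t + 1), 1 := sum_le_sum step3
    _ = (ball (t + 1 + 1) \ ball (t + 1)).card := by rw [sum_const, smul_eq_mul, mul_one]

/-- **Moore bound valued in relations.** If every vertex of the nonempty set `W` has at least `c`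
neighbours in `W` (for the adjacency induced by the duplicate-free edge family `verts` on `A`) and
no two distinct multisets of at most `k` edges of `A` have the same endpoint union, then
`(c - 2) ^ k ≤ |W|`. [folklore] -/
theorem pow_le_card_of_noRel (hA : ∀ i ∈ A, (verts i).Nodup) {k c : ℕ}
    (hnorel : ∀ S T : Multiset ι, (∀ i ∈ S, i ∈ A) → (∀ i ∈ T, i ∈ A) →
      Multiset.card S ≤ k → Multiset.card T ≤ k → (S.map verts).sum = (T.map verts).sum → S = T)
    (hdeg : ∀ v ∈ W, c ≤ (W.filter fun x => ∃ i ∈ A, verts i = {v, x}).card) (hW : W.Nonempty) :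
    (c - 2) ^ k ≤ W.card := by
  obtain ⟨r, hr⟩ := hW
  -- the breadth-first balls from `r`
  let ball : ℕ → Finset V := fun t => Nat.rec (motive := fun _ => Finset V) ∅
    (fun _ b => insert r (b ∪ W.filter fun v => ∃ u ∈ b, ∃ i ∈ A, verts i = {u, v})) t
  have hball : ball 0 = ∅ ∧ ∀ t v, v ∈ ball (t + 1) ↔
      v = r ∨ v ∈ ball t ∨ (v ∈ W ∧ ∃ u ∈ ball t, ∃ i ∈ A, verts i = {u, v}) :=
    ⟨rfl, fun t v => by
      show v ∈ insert r (ball t ∪ W.filter fun v => ∃ u ∈ ball t, ∃ i ∈ A, verts i = {u, v}) ↔ _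
      rw [mem_insert, mem_union, mem_filter]⟩
  have key : ∀ t ≤ k, (c - 2) ^ t ≤ (ball (t + 1) \ ball t).card := by
    intro t
    induction t with
    | zero => intro; simp [layer_zero hball]
    | succ t ih =>
      intro ht
      calc (c - 2) ^ (t + 1) = (c - 2) * (c - 2) ^ t := by ring
        _ ≤ (c - 2) * (ball (t + 1) \ ball t).card := Nat.mul_le_mul_left _ (ih (by omega))
        _ ≤ (ball (t + 1 + 1) \ ball (t + 1)).card := card_layer_succ_ge hball hr hA hnorel hdeg ht
  exact (key k le_rfl).trans (card_le_card fun v hv =>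
    ball_subset hball hr (k + 1) (mem_sdiff.1 hv).1)

end BFS

end Summit.ValiantsHypothesis.ValiantsHypothesis.Theorems.GirthSidonToric
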